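import Summits.BirchSwinnertonDyer.BirchSwinnertonDyer.Theorems.SignedLowerHalvesSmallImageLowerHalfBothSignsRttCharRoadE2GlueAlgebra
import Mathlib.RingTheory.Regular.Free
import Mathlib.LinearAlgebra.FreeModule.PID
import HarnessLib

/-!
# Route `SignedLowerHalves`, crux L `SmallImageLowerHalfBothSigns` (stmt-BirchSwinnertonDyer-23599), line `rtt_w3` v13 — E2, row (5′) `Col`:
# FREE DESCENT ALONG `Λ = ℤ_p⟦T⟧ → Λ_𝒪 = 𝒪⟦T⟧` — a finitely generated `Λ_𝒪`-module that is FREE OVER `Λ` is FREE OVER `Λ_𝒪`, of rank `rank_Λ / [𝒪:ℤ_p]`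

WIDTH seat `bsd-line-slh-p3-w3` g20 under LEAD `cruxlead-stmt-BirchSwinnertonDyer-23599` g10 (cell `bsd-ssimc`); BRIEF-E2 rev 3.1 §2 row `Col` (F1-carrier): «`Q ≅ XLoc_W^{(σ)}
⊗ Λ_𝒪` … and Kim–Park Prop 3.3 as «`XLoc` free of rank ONE over `𝒪_{K_v}⟦T⟧`» (honda p773229 gives rank 2 over `ℤ_p⟦T⟧`; the `𝒪_{K_v}`-structure from the formal
`𝒪_{K_v}`-module)». The step «free of rank `2` over `ℤ_p⟦T⟧` + a compatible `𝒪_{K_v}⟦T⟧`-structure ⟹ free of rank `1` over `𝒪_{K_v}⟦T⟧`» is NOT a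
tautology (a `Λ_𝒪`-module free over `Λ` need not be free over `Λ_𝒪` for a general finite ring extension); it holds here because `Λ_𝒪 = 𝒪⟦T⟧` is regular local
(Auslander–Buchsbaum), and this file proves it by the elementary route: `T` is `M`-regular, `M/TM` is a finitely generated TORSION-FREE module over the PID `𝒪`
(every non-zero `c ∈ 𝒪` divides the image of a non-zero `r ∈ ℤ_p`, and `M/TM` is `ℤ_p`-free), hence `𝒪`-free, and the local criterion
(Mathlib `Module.free_quotSMulTop_iff_free`: `M/xM` free over `B/x` with `x` in the Jacobson radical and `M`-regular ⟹ `M` free over `B`) concludes.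
THEOREMS ONLY (no definition, no named fact, no `sorry`); pure commutative algebra; companion of `…RttD2SeqRankDescent` (p780398), whose residue-field
hypothesis `dim_k(k ⊗ M) ≤ 1` it makes unnecessary. Crux L, crux M, E2 and BSD remain OPEN and are proved for NO curve by any of this.
* §1 abstract (`R → O`, `O` a local PID, `hdiv`; `M` with PINNED structures `hι : (map φ f) • x = f • x`): `moduleFinite_powerSeries_of_pins`,
  `isSMulRegular_X_of_pins`, `smul_quotSMulTop_X_eq`, `moduleFinite_quotSMulTop_X`, `isTorsionFree_quotSMulTop_X`, ★ `moduleFree_powerSeries_of_pins`,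
  `moduleFree_powerSeries_powerSeries` (`O⟦T⟧` is `R⟦T⟧`-free of rank `rank_R O`), ★ `finrank_mul_finrank_powerSeries_of_pins` (`rank_R O · rank_{O⟦T⟧} M = rank_{R⟦T⟧} M`).
* §2 the crux's carriers: ★★ `moduleFree_iwasawaAlgebraO_of_pins` / `finrank_mul_finrank_iwasawaAlgebraO_of_pins` (`Λ_𝒪 = IwasawaAlgebraO S`, `[ℚ_p(S):ℚ_p] < ∞`, pins
  `iwasawaToIwasawaO S f • x = f • x` — the currency of `LocalCondDualData.exists_moduleO` / `charRoad_E2_of_tails`), the scalar-tower forms `…_of_isScalarTower`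
  (the glue's `[Algebra Λ Λ_𝒪]` + `halg`), and ★★ `nonempty_linearEquiv_iwasawaAlgebraO_of_finrank_eq` («free of rank `[ℚ_p(S):ℚ_p]` over `Λ` ⟹ `≃ₗ[Λ_𝒪] Λ_𝒪`»,
  the `Col`-carrier shape `Q ≃ₗ[Λ_𝒪] Λ_𝒪` of `charRoad_E2_of_localisation`).
References: [Matsumura1987] §22 (local criterion; Thm. 22.3), [Washington1997] §13.2.
-/

set_option autoImplicit false
set_option linter.dupNamespace false -- D-0017: single-problem summit, the namespace repeats the problem name by design
noncomputable section

open scoped Classical Pointwise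

universe u

namespace Summit.BirchSwinnertonDyer.BirchSwinnertonDyer.Theorems.SmallImageRttD2Seq

open Literature.NumberTheory.EllipticCurves Literature.NumberTheory.Automorphic

/-! ## §1. Abstract free descent along `R⟦T⟧ → O⟦T⟧` -/

section Abstract

variable {R : Type*} [CommRing R] {O : Type*} [CommRing O] [Algebra R O]
  {M : Type*} [AddCommGroup M] [Module (PowerSeries R) M] [Module (PowerSeries O) M]

/-- A finitely generated `R⟦T⟧`-module with an `O⟦T⟧`-structure pinned by `(map φ f) • x = f • x` is finitely generated over `O⟦T⟧`
(the same generators). [folklore] -/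
theorem moduleFinite_powerSeries_of_pins
    (hι : ∀ (f : PowerSeries R) (x : M), PowerSeries.map (algebraMap R O) f • x = f • x)
    [Module.Finite (PowerSeries R) M] : Module.Finite (PowerSeries O) M := by
  obtain ⟨s, hs⟩ := Module.Finite.fg_top (R := PowerSeries R) (M := M)
  refine ⟨⟨s, ?_⟩⟩
  rw [eq_top_iff]
  rintro x -
  have hx : x ∈ Submodule.span (PowerSeries R) (s : Set M) := by rw [hs]; exact Submodule.mem_top
  induction hx using Submodule.span_induction with
  | mem y hy => exact Submodule.subset_span hy
  | zero => exact zero_mem _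
  | add y z _ _ hy hz => exact add_mem hy hz
  | smul f y _ hy => rw [← hι]; exact Submodule.smul_mem _ _ hy

/-- Under the pins, `T ∈ O⟦T⟧` acts on `M` as `T ∈ R⟦T⟧` does; on a FREE `R⟦T⟧`-module (`R` a domain) this action is injective. [folklore] -/
theorem isSMulRegular_X_of_pins [IsDomain R]
    (hι : ∀ (f : PowerSeries R) (x : M), PowerSeries.map (algebraMap R O) f • x = f • x)
    [Module.Free (PowerSeries R) M] : IsSMulRegular M (PowerSeries.X : PowerSeries O) := by
  intro x y hxy
  have h : (PowerSeries.X : PowerSeries R) • x = (PowerSeries.X : PowerSeries R) • y := by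
    have hX : (PowerSeries.X : PowerSeries O) = PowerSeries.map (algebraMap R O) PowerSeries.X := (PowerSeries.map_X _).symm
    have := hxy
    dsimp only at this
    rwa [hX, hι, hι] at this
  exact (IsRegular.of_ne_zero (PowerSeries.X_ne_zero (R := R))).isSMulRegular h

variable [Module O M] [IsScalarTower O (PowerSeries O) M]

/-- On `M/TM` every `f ∈ O⟦T⟧` acts through its constant term. [folklore] -/
theorem smul_quotSMulTop_X_eq (f : PowerSeries O) (q : QuotSMulTop (PowerSeries.X : PowerSeries O) M) :
    f • q = PowerSeries.constantCoeff f • q := by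
  obtain ⟨m, rfl⟩ := Submodule.Quotient.mk_surjective _ q
  rw [← algebraMap_smul (PowerSeries O) (PowerSeries.constantCoeff f), ← PowerSeries.C_eq_algebraMap,
    ← Submodule.Quotient.mk_smul, ← Submodule.Quotient.mk_smul, ← sub_eq_zero, ← Submodule.Quotient.mk_sub,
    Submodule.Quotient.mk_eq_zero, ← sub_smul, sub_eq_of_eq_add (PowerSeries.eq_X_mul_shift_add_const f), mul_smul]
  exact Submodule.smul_mem_pointwise_smul _ _ _ Submodule.mem_top

/-- `M/TM` is finitely generated over `O` when `M` is finitely generated over `O⟦T⟧`. [folklore] -/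
theorem moduleFinite_quotSMulTop_X [Module.Finite (PowerSeries O) M] :
    Module.Finite O (QuotSMulTop (PowerSeries.X : PowerSeries O) M) := by
  obtain ⟨s, hs⟩ := Module.Finite.fg_top (R := PowerSeries O) (M := QuotSMulTop (PowerSeries.X : PowerSeries O) M)
  refine ⟨⟨s, ?_⟩⟩
  rw [eq_top_iff]
  rintro q -
  have hq : q ∈ Submodule.span (PowerSeries O) (s : Set (QuotSMulTop (PowerSeries.X : PowerSeries O) M)) := by
    rw [hs]; exact Submodule.mem_top
  induction hq using Submodule.span_induction with
  | mem y hy => exact Submodule.subset_span hy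
  | zero => exact zero_mem _
  | add y z _ _ hy hz => exact add_mem hy hz
  | smul f y _ hy => rw [smul_quotSMulTop_X_eq]; exact Submodule.smul_mem _ _ hy

/-- **`M/TM` is torsion-free over `O`** when `M` is free over `R⟦T⟧` (`R` a domain), the `O⟦T⟧`-structure is pinned, the `O`-structure is the one by
constants, and every non-zero `c ∈ O` divides the image of a non-zero `r ∈ R` (`hdiv`; e.g. `O` the integers of a finite extension of `ℚ_p`, `R = ℤ_p`,
`c ∣ p^N`): `c • q = 0 ⟹ (φ r) • q = 0 ⟹ (C r) • m ∈ TM`, and in coordinates for an `R⟦T⟧`-basis `r · a_i(0) = 0`, so `T ∣ a_i` and `m ∈ TM`. [folklore] -/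
theorem isTorsionFree_quotSMulTop_X [IsDomain R] [Nontrivial O]
    (hι : ∀ (f : PowerSeries R) (x : M), PowerSeries.map (algebraMap R O) f • x = f • x)
    (hdiv : ∀ c : O, c ≠ 0 → ∃ r : R, r ≠ 0 ∧ c ∣ algebraMap R O r)
    [Module.Free (PowerSeries R) M] [Module.Finite (PowerSeries R) M] :
    Module.IsTorsionFree O (QuotSMulTop (PowerSeries.X : PowerSeries O) M) := by
  refine Module.IsTorsionFree.of_smul_eq_zero fun c q hcq ↦ or_iff_not_imp_left.mpr fun hc ↦ ?_
  obtain ⟨r, hr, d, hd⟩ := hdiv c hc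
  obtain ⟨m, rfl⟩ := Submodule.Quotient.mk_surjective _ q
  -- `(φ r) • m ∈ T • M`
  have h1 : (algebraMap R O r) • m ∈ (PowerSeries.X : PowerSeries O) • (⊤ : Submodule (PowerSeries O) M) := by
    rw [← Submodule.Quotient.mk_eq_zero (p := (PowerSeries.X : PowerSeries O) • (⊤ : Submodule (PowerSeries O) M)),
      Submodule.Quotient.mk_smul (p := (PowerSeries.X : PowerSeries O) • (⊤ : Submodule (PowerSeries O) M)), hd]
    have hdc : (c * d) • (Submodule.Quotient.mk m : QuotSMulTop (PowerSeries.X : PowerSeries O) M) =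
        d • c • (Submodule.Quotient.mk m : QuotSMulTop (PowerSeries.X : PowerSeries O) M) := by
      rw [mul_comm, mul_smul]
    rw [hdc, hcq, smul_zero]
  obtain ⟨m', -, hm'⟩ := (Submodule.mem_smul_pointwise_iff_exists _ _ _).mp h1
  -- read in the `R⟦T⟧`-structure: `T • m' = (C r) • m`
  have h2 : (PowerSeries.X : PowerSeries R) • m' = (PowerSeries.C r : PowerSeries R) • m := by
    rw [← hι, ← hι, PowerSeries.map_X, PowerSeries.map_C, hm', PowerSeries.C_eq_algebraMap, algebraMap_smul (PowerSeries O)]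
  -- coordinates in an `R⟦T⟧`-basis
  let b := Module.Free.chooseBasis (PowerSeries R) M
  have hcoord : ∀ i, PowerSeries.X * b.repr m' i = PowerSeries.C r * b.repr m i := fun i ↦ by
    have := congrArg (fun y ↦ b.repr y i) h2
    simpa only [map_smul, Finsupp.smul_apply, smul_eq_mul] using this
  have hdvd : ∀ i, (PowerSeries.X : PowerSeries R) ∣ b.repr m i := fun i ↦ by
    rw [PowerSeries.X_dvd_iff]
    have := congrArg PowerSeries.constantCoeff (hcoord i)
    rw [map_mul, map_mul, PowerSeries.constantCoeff_X, zero_mul, PowerSeries.constantCoeff_C] at this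
    exact (mul_eq_zero.mp this.symm).resolve_left hr
  choose a ha using hdvd
  -- `m = T • Σ a_i • b_i`
  rw [Submodule.Quotient.mk_eq_zero]
  refine (Submodule.mem_smul_pointwise_iff_exists _ _ _).mpr ⟨∑ i, a i • b i, Submodule.mem_top, ?_⟩
  rw [show (PowerSeries.X : PowerSeries O) = PowerSeries.map (algebraMap R O) PowerSeries.X from (PowerSeries.map_X _).symm, hι,
    Finset.smul_sum]
  conv_rhs => rw [← b.sum_repr m]
  exact Finset.sum_congr rfl fun i _ ↦ by rw [smul_smul, ← ha i]

omit [Module O M] [IsScalarTower O (PowerSeries O) M] in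
/-- ★ **Free descent along `R⟦T⟧ → O⟦T⟧`.** `R` a domain, `O` a local principal ideal domain with `hdiv` (every non-zero `c ∈ O` divides the image of a
non-zero element of `R`); `M` an `R⟦T⟧`-module and an `O⟦T⟧`-module with `(map φ f) • x = f • x`. If `M` is finitely generated and FREE over `R⟦T⟧`, then
`M` is FREE over `O⟦T⟧`: `T` is `M`-regular and lies in the Jacobson radical of the local ring `O⟦T⟧`, and `M/TM` is a finitely generated torsion-free, hence
free, `O`-module, i.e. free over `O⟦T⟧/(T) ≅ O`; the local criterion (Mathlib `Module.free_quotSMulTop_iff_free`) concludes.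
[cite: Matsumura1987, §22 Thm. 22.3] [folklore] -/
theorem moduleFree_powerSeries_of_pins [IsDomain R] [IsDomain O] [IsPrincipalIdealRing O] [IsLocalRing O]
    (hι : ∀ (f : PowerSeries R) (x : M), PowerSeries.map (algebraMap R O) f • x = f • x)
    (hdiv : ∀ c : O, c ≠ 0 → ∃ r : R, r ≠ 0 ∧ c ∣ algebraMap R O r)
    [Module.Free (PowerSeries R) M] [Module.Finite (PowerSeries R) M] : Module.Free (PowerSeries O) M := by
  haveI : Module.Finite (PowerSeries O) M := moduleFinite_powerSeries_of_pins hι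
  haveI : Module.FinitePresentation (PowerSeries O) M := Module.finitePresentation_of_finite _ _
  -- the `O`-structure by constants
  letI : Module O M := Module.compHom M (algebraMap O (PowerSeries O))
  haveI : IsScalarTower O (PowerSeries O) M := IsScalarTower.of_algebraMap_smul fun _ _ ↦ rfl
  -- `M/TM` is finite free over `O`
  haveI : Module.Finite O (QuotSMulTop (PowerSeries.X : PowerSeries O) M) := moduleFinite_quotSMulTop_X
  haveI : Module.IsTorsionFree O (QuotSMulTop (PowerSeries.X : PowerSeries O) M) := isTorsionFree_quotSMulTop_X hι hdiv
  haveI : Module.Free O (QuotSMulTop (PowerSeries.X : PowerSeries O) M) := Module.free_of_finite_type_torsion_free'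
  -- transport along `O ≃ O⟦T⟧/(T)`
  have hker : RingHom.ker (PowerSeries.constantCoeff (R := O)) = Ideal.span {PowerSeries.X} := by
    ext f
    rw [RingHom.mem_ker, Ideal.mem_span_singleton, PowerSeries.X_dvd_iff]
  let e' : (PowerSeries O ⧸ Ideal.span {(PowerSeries.X : PowerSeries O)}) ≃+* O :=
    (Ideal.quotEquivOfEq hker.symm).trans (RingHom.quotientKerEquivOfSurjective PowerSeries.constantCoeff_surj)
  have he : ∀ c : O, e'.symm c = Ideal.Quotient.mk _ (PowerSeries.C c) := fun c ↦ by
    rw [RingEquiv.symm_apply_eq]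
    change c = RingHom.quotientKerEquivOfSurjective PowerSeries.constantCoeff_surj
      (Ideal.quotEquivOfEq hker.symm (Ideal.Quotient.mk _ (PowerSeries.C c)))
    rw [Ideal.quotEquivOfEq_mk, RingHom.quotientKerEquivOfSurjective_apply_mk, PowerSeries.constantCoeff_C]
  have hfreeQ : Module.Free (PowerSeries O ⧸ Ideal.span {(PowerSeries.X : PowerSeries O)})
      (QuotSMulTop (PowerSeries.X : PowerSeries O) M) := by
    let bQ := Module.Free.chooseBasis O (QuotSMulTop (PowerSeries.X : PowerSeries O) M)
    refine Module.Free.of_basis (bQ.mapCoeffs e'.symm fun c q ↦ ?_)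
    rw [he]
    change (PowerSeries.C c : PowerSeries O) • q = c • q
    rw [PowerSeries.C_eq_algebraMap, algebraMap_smul]
  -- the local criterion
  have hX : (PowerSeries.X : PowerSeries O) ∈ (⊥ : Ideal (PowerSeries O)).jacobson := by
    refine IsLocalRing.maximalIdeal_le_jacobson _ ((IsLocalRing.mem_maximalIdeal _).mpr fun h ↦ ?_)
    rw [PowerSeries.isUnit_iff_constantCoeff, PowerSeries.constantCoeff_X] at h
    exact not_isUnit_zero h
  exact (Module.free_quotSMulTop_iff_free (PowerSeries O) M hX (isSMulRegular_X_of_pins hι)).mp hfreeQ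

omit [Module (PowerSeries R) M] [Module (PowerSeries O) M] [Module O M] [IsScalarTower O (PowerSeries O) M] in
/-- **`O⟦T⟧` is a free `R⟦T⟧`-module of rank `rank_R O`** for `O` finite free over `R`, for ANY algebra structure whose structure map is the coefficientwise
`map φ`: an `R`-basis `(b_i)` of `O` gives the basis `(C b_i)` (coefficientwise coordinates). [cite: Washington1997, §13.2] [folklore] -/
theorem moduleFree_powerSeries_powerSeries [Nontrivial R] [Module.Free R O] [Module.Finite R O] [Algebra (PowerSeries R) (PowerSeries O)]
    (halg : ∀ f : PowerSeries R, algebraMap (PowerSeries R) (PowerSeries O) f = PowerSeries.map (algebraMap R O) f) :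
    Module.Free (PowerSeries R) (PowerSeries O) ∧ Module.finrank (PowerSeries R) (PowerSeries O) = Module.finrank R O := by
  let b := Module.Free.chooseBasis R O
  have hcoeff : ∀ (g : Module.Free.ChooseBasisIndex R O → PowerSeries R) (k : ℕ),
      PowerSeries.coeff k (∑ i, g i • (PowerSeries.C (b i) : PowerSeries O)) = ∑ i, (PowerSeries.coeff k (g i)) • b i := fun g k ↦ by
    rw [map_sum]
    refine Finset.sum_congr rfl fun i _ ↦ ?_
    rw [Algebra.smul_def, halg, PowerSeries.coeff_mul_C, PowerSeries.coeff_map, Algebra.smul_def]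
  have hli : LinearIndependent (PowerSeries R) (fun i ↦ (PowerSeries.C (b i) : PowerSeries O)) := by
    refine Fintype.linearIndependent_iff.mpr fun g hg i ↦ PowerSeries.ext fun k ↦ ?_
    have hk := congrArg (PowerSeries.coeff k) hg
    rw [hcoeff, map_zero] at hk
    rw [map_zero]
    exact Fintype.linearIndependent_iff.mp b.linearIndependent _ hk i
  have hspan : ⊤ ≤ Submodule.span (PowerSeries R) (Set.range fun i ↦ (PowerSeries.C (b i) : PowerSeries O)) := by
    rintro F -
    let g : Module.Free.ChooseBasisIndex R O → PowerSeries R := fun i ↦ PowerSeries.mk fun k ↦ b.repr (PowerSeries.coeff k F) i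
    have hF : F = ∑ i, g i • (PowerSeries.C (b i) : PowerSeries O) := PowerSeries.ext fun k ↦ by
      rw [hcoeff]
      simp only [g, PowerSeries.coeff_mk]
      exact (b.sum_repr _).symm
    rw [hF]
    exact Submodule.sum_mem _ fun i _ ↦ Submodule.smul_mem _ _ (Submodule.subset_span ⟨i, rfl⟩)
  let B := Module.Basis.mk hli hspan
  exact ⟨Module.Free.of_basis B, by rw [Module.finrank_eq_card_basis B, Module.finrank_eq_card_chooseBasisIndex]⟩

omit [Module O M] [IsScalarTower O (PowerSeries O) M] in
/-- ★ **Rank of the free descent**: `rank_R O · rank_{O⟦T⟧} M = rank_{R⟦T⟧} M` (tower law through the free `R⟦T⟧`-module `O⟦T⟧` of rank `rank_R O`).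
[cite: Washington1997, §13.2] [folklore] -/
theorem finrank_mul_finrank_powerSeries_of_pins [IsDomain R] [IsDomain O] [IsPrincipalIdealRing O] [IsLocalRing O]
    [Module.Free R O] [Module.Finite R O]
    (hι : ∀ (f : PowerSeries R) (x : M), PowerSeries.map (algebraMap R O) f • x = f • x)
    (hdiv : ∀ c : O, c ≠ 0 → ∃ r : R, r ≠ 0 ∧ c ∣ algebraMap R O r)
    [Module.Free (PowerSeries R) M] [Module.Finite (PowerSeries R) M] :
    Module.finrank R O * Module.finrank (PowerSeries O) M = Module.finrank (PowerSeries R) M := by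
  letI : Algebra (PowerSeries R) (PowerSeries O) := (PowerSeries.map (algebraMap R O)).toAlgebra
  haveI : IsScalarTower (PowerSeries R) (PowerSeries O) M := IsScalarTower.of_algebraMap_smul fun f x ↦ hι f x
  obtain ⟨hfree, hrk⟩ := moduleFree_powerSeries_powerSeries (R := R) (O := O) fun _ ↦ rfl
  haveI := hfree
  haveI : Module.Free (PowerSeries O) M := moduleFree_powerSeries_of_pins hι hdiv
  rw [← hrk, Module.finrank_mul_finrank]

end Abstract

/-! ## §2. The crux's carriers: `Λ = IwasawaAlgebra p = ℤ_p⟦T⟧ → Λ_𝒪 = IwasawaAlgebraO S = 𝒪_S⟦T⟧` -/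

section Crux

variable {p : ℕ} [Fact p.Prime] (S : Set (PadicAlgCl p)) [FiniteDimensional ℚ_[p] (padicCoeffField S)]
  {M : Type*} [AddCommGroup M] [Module (IwasawaAlgebra p) M] [Module (IwasawaAlgebraO S) M]

/-- The ring-theoretic inputs for `𝒪 = padicCoeffIntegers S` (`[ℚ_p(S):ℚ_p] < ∞`) with the `ℤ_p`-structure `padicIntToCoeffIntegers S`: `𝒪` is finite free
over `ℤ_p` of rank `[ℚ_p(S):ℚ_p]`, and every non-zero `c ∈ 𝒪` divides a power of `p` (transport from the tree's unit ball `𝒪_{ℚ_p(S)}`).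
[cite: NeukirchANT1999, Ch. II (4.8)] [folklore] -/
theorem free_finrank_hdiv_padicCoeffIntegers :
    letI : Algebra ℤ_[p] (padicCoeffIntegers S) := (padicIntToCoeffIntegers S).toAlgebra
    Module.Free ℤ_[p] (padicCoeffIntegers S) ∧ Module.Finite ℤ_[p] (padicCoeffIntegers S) ∧
      Module.finrank ℤ_[p] (padicCoeffIntegers S) = Module.finrank ℚ_[p] (padicCoeffField S) ∧
      ∀ c : padicCoeffIntegers S, c ≠ 0 → ∃ r : ℤ_[p], r ≠ 0 ∧ c ∣ algebraMap ℤ_[p] (padicCoeffIntegers S) r := by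
  letI : Algebra ℤ_[p] (padicCoeffIntegers S) := (padicIntToCoeffIntegers S).toAlgebra
  let E := padicCoeffField S
  let eR : padicCoeffIntegers S ≃+* PadicIntermediateField.unitBall p E := RingEquiv.subringCongr (padicCoeffIntegers_eq_unitBall S)
  let eL : padicCoeffIntegers S ≃ₗ[ℤ_[p]] PadicIntermediateField.unitBall p E :=
    { eR with
      map_smul' := fun c x ↦ by
        refine Subtype.ext ?_
        change ((eR (c • x) : _) : PadicAlgCl p) = ((c • eR x : _) : PadicAlgCl p)
        rw [Algebra.smul_def, Algebra.smul_def, map_mul, Subring.coe_mul, Subring.coe_mul]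
        congr 1 }
  refine ⟨Module.Free.of_equiv eL.symm, Module.Finite.equiv eL.symm, ?_, fun c hc ↦ ?_⟩
  · rw [eL.finrank_eq, IsIntegralClosure.rank ℤ_[p] ℚ_[p] E (PadicIntermediateField.unitBall p E)]
  · have hc' : eR c ≠ 0 := fun h ↦ hc (by simpa using h)
    obtain ⟨N, hN⟩ := SmallImageRttE2Num.exists_dvd_natCast_prime_pow p E hc'
    refine ⟨(p : ℤ_[p]) ^ N, pow_ne_zero _ (by exact_mod_cast (Fact.out : p.Prime).ne_zero), ?_⟩
    have := map_dvd eR.symm hN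
    rw [RingEquiv.symm_apply_apply, map_pow, map_natCast] at this
    rwa [map_pow, map_natCast]

/-- ★★ **Free descent `Λ → Λ_𝒪` in the crux's currency (pins form).** For `Λ_𝒪 = IwasawaAlgebraO S` (`[ℚ_p(S):ℚ_p] < ∞`) and a module `M` carrying a
`Λ`-structure and a `Λ_𝒪`-structure with `iwasawaToIwasawaO S f • x = f • x` (the pins of `LocalCondDualData.exists_moduleO` /
`exists_moduleO_signedTransportDualDataSat`): if `M` is finitely generated and free over `Λ`, it is free (and finitely generated) over `Λ_𝒪`.
[cite: Matsumura1987, §22 Thm. 22.3] [folklore] -/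
theorem moduleFree_iwasawaAlgebraO_of_pins
    (hι : ∀ (f : IwasawaAlgebra p) (x : M), iwasawaToIwasawaO S f • x = f • x)
    [Module.Free (IwasawaAlgebra p) M] [Module.Finite (IwasawaAlgebra p) M] :
    Module.Free (IwasawaAlgebraO S) M ∧ Module.Finite (IwasawaAlgebraO S) M := by
  letI : Algebra ℤ_[p] (padicCoeffIntegers S) := (padicIntToCoeffIntegers S).toAlgebra
  haveI : IsPrincipalIdealRing (padicCoeffIntegers S) := isPrincipalIdealRing_padicCoeffIntegers S
  haveI : IsLocalRing (padicCoeffIntegers S) := isLocalRing_padicCoeffIntegers S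
  obtain ⟨-, -, -, hdiv⟩ := free_finrank_hdiv_padicCoeffIntegers S
  have hι' : ∀ (f : PowerSeries ℤ_[p]) (x : M), PowerSeries.map (algebraMap ℤ_[p] (padicCoeffIntegers S)) f • x = f • x := hι
  exact ⟨moduleFree_powerSeries_of_pins hι' hdiv, moduleFinite_powerSeries_of_pins hι'⟩

/-- ★★ **Rank of the free descent `Λ → Λ_𝒪`**: `[ℚ_p(S):ℚ_p] · rank_{Λ_𝒪} M = rank_Λ M`. [cite: Washington1997, §13.2] [folklore] -/
theorem finrank_mul_finrank_iwasawaAlgebraO_of_pins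
    (hι : ∀ (f : IwasawaAlgebra p) (x : M), iwasawaToIwasawaO S f • x = f • x)
    [Module.Free (IwasawaAlgebra p) M] [Module.Finite (IwasawaAlgebra p) M] :
    Module.finrank ℚ_[p] (padicCoeffField S) * Module.finrank (IwasawaAlgebraO S) M = Module.finrank (IwasawaAlgebra p) M := by
  letI : Algebra ℤ_[p] (padicCoeffIntegers S) := (padicIntToCoeffIntegers S).toAlgebra
  haveI : IsPrincipalIdealRing (padicCoeffIntegers S) := isPrincipalIdealRing_padicCoeffIntegers S
  haveI : IsLocalRing (padicCoeffIntegers S) := isLocalRing_padicCoeffIntegers S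
  obtain ⟨hfree, hfin, hrk, hdiv⟩ := free_finrank_hdiv_padicCoeffIntegers S
  haveI := hfree
  haveI := hfin
  have hι' : ∀ (f : PowerSeries ℤ_[p]) (x : M), PowerSeries.map (algebraMap ℤ_[p] (padicCoeffIntegers S)) f • x = f • x := hι
  rw [← hrk]
  exact finrank_mul_finrank_powerSeries_of_pins hι' hdiv

/-- Scalar-tower form of `moduleFree_iwasawaAlgebraO_of_pins`: `[Algebra Λ Λ_𝒪]` with structure map `iwasawaToIwasawaO S` (`halg`) and
`[IsScalarTower Λ Λ_𝒪 M]` — the typeclass shape of `charRoad_E2_of_localisation`. [cite: Matsumura1987, §22 Thm. 22.3] [folklore] -/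
theorem moduleFree_iwasawaAlgebraO_of_isScalarTower [Algebra (IwasawaAlgebra p) (IwasawaAlgebraO S)]
    (halg : ∀ f : IwasawaAlgebra p, algebraMap (IwasawaAlgebra p) (IwasawaAlgebraO S) f = iwasawaToIwasawaO S f)
    [IsScalarTower (IwasawaAlgebra p) (IwasawaAlgebraO S) M]
    [Module.Free (IwasawaAlgebra p) M] [Module.Finite (IwasawaAlgebra p) M] :
    Module.Free (IwasawaAlgebraO S) M ∧ Module.Finite (IwasawaAlgebraO S) M :=
  moduleFree_iwasawaAlgebraO_of_pins S fun f x ↦ by rw [← halg, algebraMap_smul]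

/-- Scalar-tower form of `finrank_mul_finrank_iwasawaAlgebraO_of_pins`. [cite: Washington1997, §13.2] [folklore] -/
theorem finrank_mul_finrank_iwasawaAlgebraO_of_isScalarTower [Algebra (IwasawaAlgebra p) (IwasawaAlgebraO S)]
    (halg : ∀ f : IwasawaAlgebra p, algebraMap (IwasawaAlgebra p) (IwasawaAlgebraO S) f = iwasawaToIwasawaO S f)
    [IsScalarTower (IwasawaAlgebra p) (IwasawaAlgebraO S) M]
    [Module.Free (IwasawaAlgebra p) M] [Module.Finite (IwasawaAlgebra p) M] :
    Module.finrank ℚ_[p] (padicCoeffField S) * Module.finrank (IwasawaAlgebraO S) M = Module.finrank (IwasawaAlgebra p) M :=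
  finrank_mul_finrank_iwasawaAlgebraO_of_pins S fun f x ↦ by rw [← halg, algebraMap_smul]

/-- ★★ **The `Col`-carrier shape.** If `M` is free over `Λ` of rank EXACTLY `[ℚ_p(S):ℚ_p]` and carries a pinned `Λ_𝒪`-structure, then `M ≃ₗ[Λ_𝒪] Λ_𝒪`
(free of rank one over `Λ_𝒪`). With `[ℚ_p(S):ℚ_p] = 2` this is the step «`XLoc` free of rank `2` over `ℤ_p⟦T⟧` (Kim–Park Prop. 3.3, p773229) ⟹ free of
rank `1` over `𝒪_{K_v}⟦T⟧`» of BRIEF-E2 rev 3.1 row `Col`. [cite: Matsumura1987, §22 Thm. 22.3] [cite: Washington1997, §13.2] -/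
theorem nonempty_linearEquiv_iwasawaAlgebraO_of_finrank_eq
    (hι : ∀ (f : IwasawaAlgebra p) (x : M), iwasawaToIwasawaO S f • x = f • x)
    [Module.Free (IwasawaAlgebra p) M] [Module.Finite (IwasawaAlgebra p) M]
    (hrank : Module.finrank (IwasawaAlgebra p) M = Module.finrank ℚ_[p] (padicCoeffField S)) :
    Nonempty (M ≃ₗ[IwasawaAlgebraO S] IwasawaAlgebraO S) := by
  obtain ⟨hfree, hfin⟩ := moduleFree_iwasawaAlgebraO_of_pins S hι
  haveI := hfree
  haveI := hfin
  have h := finrank_mul_finrank_iwasawaAlgebraO_of_pins S hι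
  rw [hrank] at h
  have hpos : 0 < Module.finrank ℚ_[p] (padicCoeffField S) := Module.finrank_pos
  have h1 : Module.finrank (IwasawaAlgebraO S) M = 1 := by
    have : Module.finrank ℚ_[p] (padicCoeffField S) * Module.finrank (IwasawaAlgebraO S) M =
        Module.finrank ℚ_[p] (padicCoeffField S) * 1 := by rw [mul_one, h]
    exact Nat.eq_of_mul_eq_mul_left hpos this
  obtain ⟨e⟩ := Module.nonempty_linearEquiv_of_finrank_eq_one h1
  exact ⟨e.symm⟩

end Crux

end Summit.BirchSwinnertonDyer.BirchSwinnertonDyer.Theorems.SmallImageRttD2Seq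

end
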